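import Literature.Analysis.Fourier.DirectionalFourierDecay
import HarnessLib

/-!
# Fourier decay from uniform bounds on the derivatives of a compactly supported function

Topic `Literature/Analysis/Fourier`; continues `DirectionalFourierDecay.lean`
(`|⟪v, ξ⟫|ⁿ ‖𝓕 f(ξ)‖ ≤ (2π)⁻ⁿ · sup ‖(∂_v)ⁿ f‖ · vol(supp f)`). PROVED here, dimension-free:

* `iterate_dirDeriv_eq_iteratedFDeriv` — `(∂_v)ⁿ f (x) = Dⁿf(x)(v, …, v)`, hence
  `‖(∂_v)ⁿ f (x)‖ ≤ ‖Dⁿ f(x)‖ ‖v‖ⁿ` (`norm_iterate_dirDeriv_le`);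
* **`one_add_norm_pow_mul_norm_fourier_le`** — if `f` is smooth with `vol(supp f) ≤ vol` and
  `‖Dⁿ f(x)‖ ≤ M` for all `x` and all `n ≤ N`, then for every `ξ`
  `(1 + ‖ξ‖)^N ‖𝓕 f(ξ)‖ ≤ 2^N · M · vol`
  (differentiate `N` times in the direction `ξ/‖ξ‖`), and the `((1+‖ξ‖)^N)⁻¹` form
  (`norm_fourier_le_of_iteratedFDeriv_le`).

This is the form in which `h`-uniform `C^N` symbol bounds are converted into the decay
`C_N γ^{…}(1 + |rescaled x|)^{-N}` of single-scale propagators (Benfatto–Giuliani–Mastropietro 2006,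
Lemma 2.2). Everything is PROVED; no new definitions. [folklore]
-/

noncomputable section

open MeasureTheory Real Complex Function
open scoped FourierTransform RealInnerProductSpace ContDiff
open Literature.Analysis.Calculus (dirDeriv dirDeriv_apply)

namespace Literature.Analysis.Fourier

variable {V : Type*} [NormedAddCommGroup V] [InnerProductSpace ℝ V] [FiniteDimensional ℝ V]
  [MeasurableSpace V] [BorelSpace V]
variable {E : Type*} [NormedAddCommGroup E] [NormedSpace ℂ E]

/-! ### Iterated directional derivatives through the iterated Fréchet derivative -/

omit [FiniteDimensional ℝ V] [MeasurableSpace V] [BorelSpace V] in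
/-- **`(∂_v)ⁿ f (x) = Dⁿ f(x)(v, …, v)`** for smooth `f`. [folklore] -/
theorem iterate_dirDeriv_eq_iteratedFDeriv {f : V → E} (hf : ContDiff ℝ ∞ f) (v : V) (n : ℕ) (x : V) :
    (dirDeriv v)^[n] f x = iteratedFDeriv ℝ n f x fun _ => v := by
  induction n generalizing f x with
  | zero => simp
  | succ n ih =>
    rw [Function.iterate_succ_apply]
    have hdf : ContDiff ℝ ∞ (dirDeriv v f) := contDiff_iterate_dirDeriv hf v 1
    rw [ih hdf x]
    -- `dirDeriv v f = fun y => fderiv f y v`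
    have hfun : dirDeriv v f = fun y => (fderiv ℝ f y) v := rfl
    have hfd : ContDiff ℝ ∞ fun y => fderiv ℝ f y := hf.fderiv_right (by norm_cast)
    rw [hfun, iteratedFDeriv_clm_apply_const_apply hfd (by exact_mod_cast le_top), iteratedFDeriv_succ_apply_right]
    congr 1

omit [FiniteDimensional ℝ V] [MeasurableSpace V] [BorelSpace V] in
/-- Hence `‖(∂_v)ⁿ f (x)‖ ≤ ‖Dⁿ f(x)‖ ‖v‖ⁿ`. [folklore] -/
theorem norm_iterate_dirDeriv_le {f : V → E} (hf : ContDiff ℝ ∞ f) (v : V) (n : ℕ) (x : V) :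
    ‖(dirDeriv v)^[n] f x‖ ≤ ‖iteratedFDeriv ℝ n f x‖ * ‖v‖ ^ n := by
  rw [iterate_dirDeriv_eq_iteratedFDeriv hf v n x]
  refine (ContinuousMultilinearMap.le_opNorm _ _).trans (le_of_eq ?_)
  rw [Finset.prod_const, Finset.card_univ, Fintype.card_fin]

/-! ### Decay of the Fourier transform -/

/-- **Fourier decay from uniform derivative bounds**: if `f` is smooth, `vol(supp f) ≤ vol` and
`‖Dⁿf(x)‖ ≤ M` for all `x` and `n ≤ N`, then `(1 + ‖ξ‖)^N ‖𝓕 f(ξ)‖ ≤ 2^N M vol`. [folklore] -/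
theorem one_add_norm_pow_mul_norm_fourier_le {f : V → E} (hf : ContDiff ℝ ∞ f) (hsupp : HasCompactSupport f)
    {N : ℕ} {M vol : ℝ} (hM : ∀ n ≤ N, ∀ x, ‖iteratedFDeriv ℝ n f x‖ ≤ M)
    (hvol : (volume (tsupport f)).toReal ≤ vol) (ξ : V) :
    (1 + ‖ξ‖) ^ N * ‖𝓕 f ξ‖ ≤ 2 ^ N * (M * vol) := by
  have hM0 : 0 ≤ M := (norm_nonneg _).trans (hM 0 (Nat.zero_le _) 0)
  have hvol0 : 0 ≤ vol := le_trans ENNReal.toReal_nonneg hvol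
  have hMv : 0 ≤ M * vol := mul_nonneg hM0 hvol0
  -- order zero: `‖𝓕 f ξ‖ ≤ M vol`
  have h0 : ‖𝓕 f ξ‖ ≤ M * vol := by
    have hb : ∀ x, ‖(dirDeriv (0 : V))^[0] f x‖ ≤ M := fun x => by
      have := hM 0 (Nat.zero_le _) x
      rw [norm_iteratedFDeriv_zero] at this
      simpa using this
    have := pow_inner_mul_norm_fourier_le_of_bound hf hsupp (0 : V) ξ 0 hb hvol
    simpa using this
  -- order `N` in the direction `ξ/‖ξ‖`: `‖ξ‖^N ‖𝓕 f ξ‖ ≤ M vol`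
  have hN : ‖ξ‖ ^ N * ‖𝓕 f ξ‖ ≤ M * vol := by
    rcases eq_or_ne ξ 0 with rfl | hξ
    · cases N with
      | zero => simpa using h0
      | succ N => rw [norm_zero, zero_pow (Nat.succ_ne_zero _), zero_mul]; exact hMv
    · set v : V := (‖ξ‖⁻¹ : ℝ) • ξ with hv
      have hnξ : ‖ξ‖ ≠ 0 := norm_ne_zero_iff.2 hξ
      have hvn : ‖v‖ = 1 := by rw [hv, norm_smul, norm_inv, norm_norm, inv_mul_cancel₀ hnξ]
      have hinner : ⟪v, ξ⟫ = ‖ξ‖ := by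
        rw [hv, real_inner_smul_left, real_inner_self_eq_norm_sq]; field_simp
      have hb : ∀ x, ‖(dirDeriv v)^[N] f x‖ ≤ M := fun x =>
        (norm_iterate_dirDeriv_le hf v N x).trans (by rw [hvn, one_pow, mul_one]; exact hM N le_rfl x)
      have h := pow_inner_mul_norm_fourier_le_of_bound hf hsupp v ξ N hb hvol
      rw [hinner, abs_of_nonneg (norm_nonneg _)] at h
      refine h.trans ?_
      have h2π : (2 * π)⁻¹ ^ N ≤ 1 :=
        pow_le_one₀ (by positivity) (inv_le_one_of_one_le₀ (by linarith [Real.two_le_pi]))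
      exact (mul_le_mul_of_nonneg_right h2π hMv).trans (by rw [one_mul])
  -- combine: `(1 + a)^N ≤ 2^N (max 1 a)^N` and `(max 1 a)^N ‖𝓕 f ξ‖ ≤ M vol`
  have hmax : (max 1 ‖ξ‖) ^ N * ‖𝓕 f ξ‖ ≤ M * vol := by
    rcases le_total ‖ξ‖ 1 with h1 | h1
    · rw [max_eq_left h1, one_pow, one_mul]; exact h0
    · rw [max_eq_right h1]; exact hN
  have hle : (1 + ‖ξ‖) ^ N ≤ 2 ^ N * (max 1 ‖ξ‖) ^ N := by
    rw [← mul_pow]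
    have h1 : (1 : ℝ) ≤ max 1 ‖ξ‖ := le_max_left _ _
    have h2 : ‖ξ‖ ≤ max 1 ‖ξ‖ := le_max_right _ _
    exact pow_le_pow_left₀ (by positivity) (by linarith) N
  calc (1 + ‖ξ‖) ^ N * ‖𝓕 f ξ‖ ≤ 2 ^ N * (max 1 ‖ξ‖) ^ N * ‖𝓕 f ξ‖ :=
        mul_le_mul_of_nonneg_right hle (norm_nonneg _)
    _ = 2 ^ N * ((max 1 ‖ξ‖) ^ N * ‖𝓕 f ξ‖) := by ring
    _ ≤ 2 ^ N * (M * vol) := mul_le_mul_of_nonneg_left hmax (by positivity)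

/-- The same in decay form: `‖𝓕 f(ξ)‖ ≤ 2^N M vol · ((1 + ‖ξ‖)^N)⁻¹`. [folklore] -/
theorem norm_fourier_le_of_iteratedFDeriv_le {f : V → E} (hf : ContDiff ℝ ∞ f) (hsupp : HasCompactSupport f)
    {N : ℕ} {M vol : ℝ} (hM : ∀ n ≤ N, ∀ x, ‖iteratedFDeriv ℝ n f x‖ ≤ M)
    (hvol : (volume (tsupport f)).toReal ≤ vol) (ξ : V) :
    ‖𝓕 f ξ‖ ≤ 2 ^ N * (M * vol) * ((1 + ‖ξ‖) ^ N)⁻¹ := by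
  have hpos : 0 < (1 + ‖ξ‖) ^ N := by positivity
  rw [le_mul_inv_iff₀ hpos, mul_comm]
  exact one_add_norm_pow_mul_norm_fourier_le hf hsupp hM hvol ξ

end Literature.Analysis.Fourier

end
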